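import Summits.CriticalPhenomena.Ising3D.ExclusionSentencesAlg

/-!
# Exclusion sentences — kernel-checked 2D-control instances of the ALG sentence
(cell `pub-ising3x`, seat recog-1)

HONEST FRAMING: lottery ticket; floor = tightest certified 3D Ising CFT bounds; no exact-solution
claim without a proof.

Instances of `algExcluded` (`ExclusionSentencesAlg.lean`) on the 2D CONTROL values of the cell's blind
protocol (SCOPE.md §4: Onsager/BPZ `Δ_σ = 1/8`, `Δ_ε = 1`, recognised blind at 6 resp. 5 certified digits,
round R2), one `decide +kernel` per degree `d = 1, …, 6` at the FULL table heights of FAMILIES-v1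
(`H = 1024, 64, 12, 6, 3, 2`): within `10⁻⁶` of `1/8` (resp. `10⁻⁵` of `1`) every algebraic number of
degree `d ≤ 6` within the table height is a root of `8X − 1` (resp. `X − 1`) — i.e. it IS the control
value (`control_sigma_alg_unique`, `control_eps_alg_unique`). This is the kernel twin of the blind round's
ALG column (§3.7/§3.8: ALG members reported, never accepted) and the first kernel-checked statement of the
cell about IRRATIONAL family members. The exception lists were produced by the Python twin
`alg_exceptions.py`, which finds the same single polynomial per window and cross-checks, against the
independent enumerator `exactrec.algenum` (engines, 0.3.8), that every one of the 94 resp. 21 866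
bounded-height descriptions `(p, ξ)` with `ξ` inside the window is a root of it — two implementations
before the kernel. Measured kernel time: `Δ_σ` sentences ≈ 1 s each; `Δ_ε` sentences 25–50 s each (the
`d = 2, 3, 4` loops visit 6 176 / 4 978 / 7 841 candidates, most of them reducible multiples of `X − 1`
discharged by deflation). No 3D digit is used anywhere.
-/

namespace Summit.CriticalPhenomena.Ising3D

/-- The six `(degree, height)` rungs of the frozen family ALG (FAMILIES-v1: exhaustive table heights
`H = 1024, 64, 12, 6, 3, 2` for `d = 1, …, 6`). -/
def algTable : List (ℕ × ℕ) := [(1, 1024), (2, 64), (3, 12), (4, 6), (5, 3), (6, 2)]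

/-! ### `Δ_σ = 1/8` at six certified digits -/

/-- Degree 1 (rationals of height `≤ 1024`): the only one within `10⁻⁶` of `1/8` is `1/8`. -/
theorem algExcluded_control_sigma_d1 :
    algExcluded 1 1024 (1 / 8 - 1 / 10 ^ 6) (1 / 8 + 1 / 10 ^ 6) 6 6 [[-1, 8]] = true := by
  decide +kernel

/-- Degree 2, height `≤ 64`: no quadratic irrational of the table within `10⁻⁶` of `1/8`. -/
theorem algExcluded_control_sigma_d2 :
    algExcluded 2 64 (1 / 8 - 1 / 10 ^ 6) (1 / 8 + 1 / 10 ^ 6) 6 6 [[-1, 8]] = true := by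
  decide +kernel

/-- Degree 3, height `≤ 12`. -/
theorem algExcluded_control_sigma_d3 :
    algExcluded 3 12 (1 / 8 - 1 / 10 ^ 6) (1 / 8 + 1 / 10 ^ 6) 6 6 [[-1, 8]] = true := by
  decide +kernel

/-- Degree 4, height `≤ 6`. -/
theorem algExcluded_control_sigma_d4 :
    algExcluded 4 6 (1 / 8 - 1 / 10 ^ 6) (1 / 8 + 1 / 10 ^ 6) 6 6 [[-1, 8]] = true := by
  decide +kernel

/-- Degree 5, height `≤ 3`. -/
theorem algExcluded_control_sigma_d5 :
    algExcluded 5 3 (1 / 8 - 1 / 10 ^ 6) (1 / 8 + 1 / 10 ^ 6) 6 6 [[-1, 8]] = true := by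
  decide +kernel

/-- Degree 6, height `≤ 2`. -/
theorem algExcluded_control_sigma_d6 :
    algExcluded 6 2 (1 / 8 - 1 / 10 ^ 6) (1 / 8 + 1 / 10 ^ 6) 6 6 [[-1, 8]] = true := by
  decide +kernel

/-- … and the degree-1 sentence is not vacuous: with an empty exception list the checker answers `false`
(it finds the candidate `8X − 1`, which has the root `1/8` inside). -/
theorem algExcluded_control_sigma_nonvacuous :
    algExcluded 1 1024 (1 / 8 - 1 / 10 ^ 6) (1 / 8 + 1 / 10 ^ 6) 6 6 [] = false := by
  decide +kernel

/-- Consequence in the shape the floor paper prints: a real number within `10⁻⁶` of `1/8` that is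
algebraic of some degree `d ≤ 6` within the table height `H_d` of FAMILIES-v1 IS `1/8`. -/
theorem control_sigma_alg_unique {x : ℝ}
    (hx : ((1 / 8 - 1 / 10 ^ 6 : ℚ) : ℝ) ≤ x ∧ x ≤ ((1 / 8 + 1 / 10 ^ 6 : ℚ) : ℝ)) {d H : ℕ}
    (hdH : (d, H) ∈ algTable) (hmem : x ∈ algFamily d H) : x = 1 / 8 := by
  have key : ∃ q ∈ [[-1, 8]], evalL q x = 0 := by
    simp only [algTable, List.mem_cons, Prod.mk.injEq, List.not_mem_nil, or_false] at hdH
    rcases hdH with ⟨rfl, rfl⟩ | ⟨rfl, rfl⟩ | ⟨rfl, rfl⟩ | ⟨rfl, rfl⟩ | ⟨rfl, rfl⟩ | ⟨rfl, rfl⟩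
    · exact algExcluded_sound algExcluded_control_sigma_d1 hx hmem
    · exact algExcluded_sound algExcluded_control_sigma_d2 hx hmem
    · exact algExcluded_sound algExcluded_control_sigma_d3 hx hmem
    · exact algExcluded_sound algExcluded_control_sigma_d4 hx hmem
    · exact algExcluded_sound algExcluded_control_sigma_d5 hx hmem
    · exact algExcluded_sound algExcluded_control_sigma_d6 hx hmem
  obtain ⟨q, hq, h0⟩ := key
  simp only [List.mem_singleton] at hq
  subst hq
  simp only [evalL_cons, evalL_nil] at h0
  push_cast at h0
  linarith

/-! ### `Δ_ε = 1` at five certified digits -/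

/-- Degree 1 (rationals of height `≤ 1024`): the only one within `10⁻⁵` of `1` is `1`. -/
theorem algExcluded_control_eps_d1 :
    algExcluded 1 1024 (1 - 1 / 10 ^ 5) (1 + 1 / 10 ^ 5) 6 6 [[-1, 1]] = true := by
  decide +kernel

/-- Degree 2, height `≤ 64` (the 3 779 reducible members `(X − 1)(uX + v)` of the window are discharged
inside the checker by exact deflation against `X − 1`). -/
theorem algExcluded_control_eps_d2 :
    algExcluded 2 64 (1 - 1 / 10 ^ 5) (1 + 1 / 10 ^ 5) 6 6 [[-1, 1]] = true := by
  decide +kernel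

/-- Degree 3, height `≤ 12`. -/
theorem algExcluded_control_eps_d3 :
    algExcluded 3 12 (1 - 1 / 10 ^ 5) (1 + 1 / 10 ^ 5) 6 6 [[-1, 1]] = true := by
  decide +kernel

/-- Degree 4, height `≤ 6`. -/
theorem algExcluded_control_eps_d4 :
    algExcluded 4 6 (1 - 1 / 10 ^ 5) (1 + 1 / 10 ^ 5) 6 6 [[-1, 1]] = true := by
  decide +kernel

/-- Degree 5, height `≤ 3`. -/
theorem algExcluded_control_eps_d5 :
    algExcluded 5 3 (1 - 1 / 10 ^ 5) (1 + 1 / 10 ^ 5) 6 6 [[-1, 1]] = true := by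
  decide +kernel

/-- Degree 6, height `≤ 2`. -/
theorem algExcluded_control_eps_d6 :
    algExcluded 6 2 (1 - 1 / 10 ^ 5) (1 + 1 / 10 ^ 5) 6 6 [[-1, 1]] = true := by
  decide +kernel

/-- A real number within `10⁻⁵` of `1` that is algebraic of some degree `d ≤ 6` within the table height
`H_d` IS `1`. -/
theorem control_eps_alg_unique {x : ℝ}
    (hx : ((1 - 1 / 10 ^ 5 : ℚ) : ℝ) ≤ x ∧ x ≤ ((1 + 1 / 10 ^ 5 : ℚ) : ℝ)) {d H : ℕ}
    (hdH : (d, H) ∈ algTable) (hmem : x ∈ algFamily d H) : x = 1 := by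
  have key : ∃ q ∈ [[-1, 1]], evalL q x = 0 := by
    simp only [algTable, List.mem_cons, Prod.mk.injEq, List.not_mem_nil, or_false] at hdH
    rcases hdH with ⟨rfl, rfl⟩ | ⟨rfl, rfl⟩ | ⟨rfl, rfl⟩ | ⟨rfl, rfl⟩ | ⟨rfl, rfl⟩ | ⟨rfl, rfl⟩
    · exact algExcluded_sound algExcluded_control_eps_d1 hx hmem
    · exact algExcluded_sound algExcluded_control_eps_d2 hx hmem
    · exact algExcluded_sound algExcluded_control_eps_d3 hx hmem
    · exact algExcluded_sound algExcluded_control_eps_d4 hx hmem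
    · exact algExcluded_sound algExcluded_control_eps_d5 hx hmem
    · exact algExcluded_sound algExcluded_control_eps_d6 hx hmem
  obtain ⟨q, hq, h0⟩ := key
  simp only [List.mem_singleton] at hq
  subst hq
  simp only [evalL_cons, evalL_nil] at h0
  push_cast at h0
  linarith

end Summit.CriticalPhenomena.Ising3D
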